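import Summits.KontsevichZagierPeriods.KontsevichZagierPeriods.Theses.OctahedralSymmetry

/-!
# Route OctahedralSymmetry — `Assembly`: the route's items imply the summit statement

Problem `KontsevichZagierPeriods`, route `OctahedralSymmetry`, item stmt-KontsevichZagierPeriods-11043
(`Assembly`, assembly, rank 1). The route declaration `Assembly` is the curried implication
`ZhaoRelationInKZ → LevelFourStuffleInKZ → OctahedralInvolutionMove → LevelFourSectorKernel →
KontsevichZagierPeriods`: the three typed level-4 relator families of the route (Zhao's
non-standard weight-3 relation, the depth block (1)×(2) of the level-4 stuffle, and the octahedral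
involution `t ↦ (1 - t)/(1 + t)` as one change of variables, each realised inside `KZ.relations`)
together with the enlarged-kernel item `LevelFourSectorKernel` (every formal combination of value
`0` lies in `KZ.relations ⊔ closure(the three relator families)`) imply the summit statement
`KontsevichZagierPeriods` (two rational-shape integral representations with equal values are
equivalent under the four moves). This is literally the type of the route's deciding theorem
`OctahedralSymmetry.closes` (the closure of the adjoined relators is `≤ KZ.relations` by the three
hypotheses — `sup_le` + `AddSubgroup.closure_le` + cases — and for representations `r, r'` with
equal values `KZ.eval ([r] - [r']) = 0`, so `[r] - [r']` is a relation), so the item is settled by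
citing it.

Sources: M. Kontsevich, D. Zagier, *Periods* (2001), §1.2 (Conjecture 1 and its kernel
reformulation); J. Zhao, *Multiple polylogarithm values at roots of unity*, C. R. Acad. Sci.
Paris 346 (2008), arXiv:0810.1064, §4 (the octahedral symmetry behind the route's items).
Deliberately NOT here: any claim about the four hypotheses themselves — the result is the
implication only (unconditional as an implication).
-/

namespace Summit.KontsevichZagierPeriods.OctahedralSymmetry

/-- Settles stmt-KontsevichZagierPeriods-11043: the route declaration `OctahedralSymmetry.Assembly`
(`ZhaoRelationInKZ → LevelFourStuffleInKZ → OctahedralInvolutionMove → LevelFourSectorKernel →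
KontsevichZagierPeriods`) holds — after unfolding it is exactly the route's kernel-checked deciding
theorem `OctahedralSymmetry.closes` (given the three relator families, the adjoined closure in
`LevelFourSectorKernel` collapses into `KZ.relations`, and equal values of two representations
`r, r'` give `KZ.eval ([r] - [r']) = 0`, hence `[r] - [r'] ∈ KZ.relations`).
[Kontsevich–Zagier 2001, §1.2] [folklore] -/
theorem assembly_proof :
    Summit.KontsevichZagierPeriods.KontsevichZagierPeriods.Theses.OctahedralSymmetry.Assembly := by
  unfold Summit.KontsevichZagierPeriods.KontsevichZagierPeriods.Theses.OctahedralSymmetry.Assembly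
  exact Summit.KontsevichZagierPeriods.KontsevichZagierPeriods.Theses.OctahedralSymmetry.closes

end Summit.KontsevichZagierPeriods.OctahedralSymmetry
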